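/-
Copyright (c) 2026 the pub-hodgecm-mathlib formalisation cell (harness21).  Prover seat hodgecm-mathlib-K2E1-p16 (g2), Track B «K2-LIT» ENGINE E1, h413 = `stmt-HodgeConjecture-24833`,
route `HCCMUnconditional`, R90-S8 «ContSpec-n½» #2∕#3 chain, deal S8-R83 (1) (S8 dealer R90-CS-plan (g2)): THE `hMS` PAYER «OF LETTERS» — the truncated χ-Eisenstein family of
`U(2,1)` has `‖(z − z₀)•Λ^T Ẽ_χ(z)‖_{L²}` BOUNDED near a real pole `z₀` (the middle pole `3∕2`), from the Maass–Selberg diagonal relation in the THREE-SCALAR section currency.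
-/
import Summits.HodgeConjecture.HodgeConjecture.Theorems.K2E1MaassSelbergDiagonalRealAxisCMThree   -- ★ (K2E4-p14) the scalar heart at `2`: §1 `exists_abs_im_le_mul_abs_im`, §2 `contDiff_cpow_neg_sub_conj` ∕ `norm_cpow_neg_sub_conj` ∕ `norm_conj_sub_self_div`, `exists_norm_outer_le`, §4 `eventually_norm_le_of_im_ne_zero`
import HarnessLib

/-!
# h413 ∕ R90-S8 #2∕#3 chain — `K2E1ChiEisensteinL2BoundMiddlePoleCMThree`: THE `L²`-BOUND `‖(z − z₀)•F_T(z)‖ ≤ C` OF THE TRUNCATED χ-FAMILY NEAR A REAL POLE, FROM THE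
# MAASS–SELBERG DIAGONAL RELATION (three-scalar section currency) — the `hMS` letter of ★ `K2E1ChiContinuedEisensteinMiddleResidueCMThree.exists_L2Residue_of_section`

Cell `pub/hodgecm-mathlib`, crux H413 = `stmt-HodgeConjecture-24833`; S8 dealer R90-CS-plan (g2) S8-R83 (1); census `K2/K2E1-p16/g2/CENSUS-MSmid.md`.  Consumer chain: `hMS` ⇒ ★ p862783
`exists_L2Residue_of_section` ⇒ R90-C133-p02's `hRes`∕`hId` ⇒ `hr2` (K2E2-p12's (V) seam).  THEOREMS ONLY (no `def`, no `instance`, no notation, no named-fact hypothesis, no `sorry`);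
lane `--supports stmt-HodgeConjecture-24833 --as helper` (count-neutral).  Pure complex analysis + a Banach-valued family (`X := L²(μ)` at the consumer); imports ★
`K2E1MaassSelbergDiagonalRealAxisCMThree` only.

THE MATHEMATICS ([MoeglinWaldspurger1995, IV.2.3, IV.3.12 (a)]; [Arthur1980TraceFormulaII, §4]; [Langlands1976, §7]).  The ★ spherical pole-control chain (K2E4-p14:
`…DiagonalRealAxisCMThree` FILE 1 → `K2E1SphericalEisensteinL2BoundCMThree.ms2_of_road`) bounds `‖(z − 2)•Λ^T Ẽ(z)‖` from the diagonal Maass–Selberg four-term `‖Λ^T E(z)‖² = R(z,z;c̃)`, but its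
scalar heart ★ `exists_normSq_mul_norm_fourTerm_diag_le_two` is HARD-WIRED to the pole `2` and to a RANK-ONE section (last weight `|c̃(z)φ₀|²`).  For the χ-family at a level the
diagonal relation has THREE section scalars — `a = κm‖φ‖²` (constant), `w(z) = κm⟨φ, M(z)φ⟩` (simple pole at the middle point `3∕2`, REAL on the real axis by the adjoint letter),
`β(z) = κm‖M(z)φ‖²` (double pole):  `R_χ(z) = Cμ·CK·( a·T^{z+z̄−2}∕(z+z̄−2) + conj(w z)·T^{z−z̄}∕(z−z̄) − w z·T^{−(z−z̄)}∕(z−z̄) − β z·T^{−(z+z̄−2)}∕(z+z̄−2) )` (spherical case: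
`w = κm c̃|φ₀|²`, `β = κm|c̃|²|φ₀|²`).  The two `1∕(z−z̄)` summands recombine to `(conj k − k)∕(z − z̄)`, `k = T^{−(z−z̄)}·w` (§1), of norm `|Im k|∕|Im z|`; at a REAL pole `z₀ > 1` with
`(z−z₀)·w = d` analytic and `w` real on the punctured real trace, `|z−z₀|²·k = conj(z−z₀)·T^{−(z−z̄)}·d` is `ℝ`-`C¹` and REAL on the real axis, so `|z−z₀|²·|Im k| ≤ C·|Im z|` near `z₀`
(★ `exists_abs_im_le_mul_abs_im`); the outer `a`-term is bounded and `|z−z₀|²·β` is bounded by the letter `hβ` (`= κm‖(z−z₀)M(z)φ‖²`).  Hence `|z−z₀|²·‖R_χ(z)‖ ≤ C` off the real axis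
(§2), so the RELATION LETTER `‖F_T(z)‖² ≤ ‖R_χ(z)‖` gives `‖(z−z₀)•F_T(z)‖ ≤ √C` off the real axis and, by continuity of `F_T`, everywhere near `z₀` (★ `eventually_norm_le_of_im_ne_zero`) (§3).
* §1 `chiFourTerm_eq` (recombination), `norm_chiFourTerm_le`.
* §2 **`exists_normSq_mul_norm_chiFourTerm_le`** — the `|z − z₀|²`-weighted bound at a real pole `z₀ > 1`.
* §3 HEAD **`msBound_of_chiRelation`** — `∃ C, ∀ᶠ z in 𝓝[≠] z₀, ‖(z − z₀)•F_T z‖ ≤ C` from the relation letter `hMSrel`, the pole letters `hd hdw hreal hβ`, and continuity; §4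
  **`msBound_middlePole_of_chiRelation`** — the `z₀ = 3∕2` spelling (`hMS` of ★ p862783 verbatim).
HONEST LABEL: HC_CM is proved only modulo the 7 printed citations (2 remaining named inputs: hLiu418 = `stmt-HodgeConjecture-24832`, h413 = `stmt-HodgeConjecture-24833`) until rung 0
closes; this file asserts no named fact and closes no socket; it pays `hMS` MODULO the visible letters `hMSrel` (the χ Maass–Selberg diagonal relation near `z₀` — payer: the χ-twin of ★
`normSq_family_eq_fourTerm_on'` over ★ `K2E1MaassSelbergFamilyCMThree`), `hreal` (⇐ adjoint letter), `hd`∕`hdw` and `hβ` (scattering pole data at `z₀`); count-neutral.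

## References
* [MoeglinWaldspurger1995] C. Mœglin, J.-L. Waldspurger, *Spectral decomposition and Eisenstein series* (1995), IV.2.3, IV.3.12 (a).
* [Arthur1980TraceFormulaII] J. Arthur, *A trace formula for reductive groups II*, Compositio Math. 40 (1980), §4.
* [Langlands1976] R. P. Langlands, *On the Functional Equations Satisfied by Eisenstein Series*, LNM 544 (1976), §7.
-/

set_option autoImplicit false
-- the mandated namespace repeats the single-problem summit's segment (`HodgeConjecture.HodgeConjecture`)
set_option linter.dupNamespace false

noncomputable section

open Set Filter Topology Metric Complex
open scoped ComplexConjugate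
open Literature.NumberTheory.EllipticCurves.ModularForms (conj_ofReal_cpow)
open Summit.HodgeConjecture.HodgeConjecture.Cruxes.H413.K2E1MaassSelbergDiagonalRealAxisCMThree (exists_abs_im_le_mul_abs_im norm_cpow_neg_sub_conj contDiff_cpow_neg_sub_conj
  norm_conj_sub_self_div exists_norm_outer_le eventually_norm_le_of_im_ne_zero)

namespace Summit.HodgeConjecture.HodgeConjecture.Cruxes.H413.K2E1ChiEisensteinL2BoundMiddlePoleCMThree

/-! ## §1 The three-scalar diagonal four-term and its recombination -/

/-- **THE RECOMBINATION OF THE χ DIAGONAL FOUR-TERM**: with `k := T^{−(z−z̄)}·w`,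
`Cμ·CK·( a·T^{z+z̄−2}∕(z+z̄−2) + conj(w)·T^{z−z̄}∕(z−z̄) − w·T^{−(z−z̄)}∕(z−z̄) − β·T^{−(z+z̄−2)}∕(z+z̄−2) ) = Cμ·CK·( a·T^{z+z̄−2}∕(z+z̄−2) + (conj k − k)∕(z − z̄) − β·T^{−(z+z̄−2)}∕(z+z̄−2) )`
— the three-scalar (`a`, `w`, `β`) twin of ★ `fourTerm_diag_eq`. [cite: MoeglinWaldspurger1995, IV.2.3] -/
theorem chiFourTerm_eq (Cμ CK a : ℝ) {T : ℝ} (hT : 0 < T) (w β z : ℂ) :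
    ((Cμ : ℝ) : ℂ) * (((CK : ℝ) : ℂ) *
        ((((T : ℝ) : ℂ) ^ (z + conj z - 2) / (z + conj z - 2)) * ((a : ℝ) : ℂ)
          + (((T : ℝ) : ℂ) ^ (z - conj z) / (z - conj z)) * conj w
          - (((T : ℝ) : ℂ) ^ (-(z - conj z)) / (z - conj z)) * w
          - (((T : ℝ) : ℂ) ^ (-(z + conj z - 2)) / (z + conj z - 2)) * β)) =
      (((Cμ : ℝ) : ℂ) * ((CK : ℝ) : ℂ)) *
        (((T : ℝ) : ℂ) ^ (z + conj z - 2) / (z + conj z - 2) * ((a : ℝ) : ℂ)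
          + (conj (((T : ℝ) : ℂ) ^ (-(z - conj z)) * w) - ((T : ℝ) : ℂ) ^ (-(z - conj z)) * w) / (z - conj z)
          - ((T : ℝ) : ℂ) ^ (-(z + conj z - 2)) / (z + conj z - 2) * β) := by
  have hc1 : conj (((T : ℝ) : ℂ) ^ (-(z - conj z)) * w) = ((T : ℝ) : ℂ) ^ (z - conj z) * conj w := by
    rw [map_mul, conj_ofReal_cpow hT.le, map_neg, map_sub, conj_conj, neg_sub]
  rw [hc1]
  simp only [div_eq_mul_inv]
  ring

/-- **THE NORM OF THE χ DIAGONAL FOUR-TERM**, off the real axis: `≤ ‖Cμ CK‖·( |a|·‖T^{z+z̄−2}∕(z+z̄−2)‖ + |Im k z|∕|Im z| + ‖T^{−(z+z̄−2)}∕(z+z̄−2)‖·‖β‖ )`, `k = T^{−(z−z̄)}·w`.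
[cite: MoeglinWaldspurger1995, IV.2.3] -/
theorem norm_chiFourTerm_le (Cμ CK a : ℝ) {T : ℝ} (hT : 0 < T) (w β z : ℂ) :
    ‖((Cμ : ℝ) : ℂ) * (((CK : ℝ) : ℂ) *
        ((((T : ℝ) : ℂ) ^ (z + conj z - 2) / (z + conj z - 2)) * ((a : ℝ) : ℂ)
          + (((T : ℝ) : ℂ) ^ (z - conj z) / (z - conj z)) * conj w
          - (((T : ℝ) : ℂ) ^ (-(z - conj z)) / (z - conj z)) * w
          - (((T : ℝ) : ℂ) ^ (-(z + conj z - 2)) / (z + conj z - 2)) * β))‖ ≤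
      ‖((Cμ : ℝ) : ℂ) * ((CK : ℝ) : ℂ)‖ *
        (‖((T : ℝ) : ℂ) ^ (z + conj z - 2) / (z + conj z - 2)‖ * |a| + |(((T : ℝ) : ℂ) ^ (-(z - conj z)) * w).im| / |z.im|
          + ‖((T : ℝ) : ℂ) ^ (-(z + conj z - 2)) / (z + conj z - 2)‖ * ‖β‖) := by
  rw [chiFourTerm_eq Cμ CK a hT w β z, norm_mul]
  refine mul_le_mul_of_nonneg_left ?_ (norm_nonneg _)
  refine (norm_sub_le _ _).trans (add_le_add ((norm_add_le _ _).trans (add_le_add ?_ ?_)) ?_)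
  · rw [norm_mul, Complex.norm_real, Real.norm_eq_abs]
  · rw [norm_conj_sub_self_div]
  · rw [norm_mul]

/-! ## §2 The `|z − z₀|²`-weighted bound at a real pole -/

/-- **THE `|z − z₀|²`-WEIGHTED χ FOUR-TERM IS BOUNDED NEAR A REAL POLE `z₀ > 1`** (off the real axis): `w` has a simple pole at `z₀` (`d = (z−z₀)·w` near `z₀`, `d` analytic at `z₀`) and is
REAL at the real points `x ≠ z₀` near `z₀` (reflection: `⟨φ, M(x)φ⟩ ∈ ℝ`), and `|z−z₀|²·β` is bounded near `z₀` (`hβ`: `= κm‖(z−z₀)M(z)φ‖²`).  With `k₂ := conj(z−z₀)·T^{−(z−z̄)}·d` (`C¹`, real on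
the real axis): `|z−z₀|²·|Im k| = |Im k₂| ≤ C|Im z|` (★ `exists_abs_im_le_mul_abs_im`); the outer `a`-term carries `|z−z₀|² ≤ 1`.  The ★ `exists_normSq_mul_norm_fourTerm_diag_le_two`
mechanism at a general real pole and in three-scalar currency. [cite: MoeglinWaldspurger1995, IV.2.3, IV.3.12 (a)] [cite: Arthur1980TraceFormulaII, §4] -/
theorem exists_normSq_mul_norm_chiFourTerm_le (Cμ CK a : ℝ) {T : ℝ} (hT : 0 < T) {z₀ : ℝ} (hz₀ : 1 < z₀) {w d β : ℂ → ℂ}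
    (hd : AnalyticAt ℂ d (z₀ : ℂ)) (hdw : ∀ᶠ z : ℂ in 𝓝[≠] (z₀ : ℂ), d z = (z - z₀) * w z) (hreal : ∀ᶠ x : ℝ in 𝓝[≠] z₀, (w (x : ℂ)).im = 0)
    (hβ : ∃ B : ℝ, ∀ᶠ z : ℂ in 𝓝[≠] (z₀ : ℂ), ‖z - z₀‖ ^ 2 * ‖β z‖ ≤ B) :
    ∃ C : ℝ, ∀ᶠ z : ℂ in 𝓝[≠] (z₀ : ℂ), z.im ≠ 0 →
      ‖z - z₀‖ ^ 2 * ‖((Cμ : ℝ) : ℂ) * (((CK : ℝ) : ℂ) *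
        ((((T : ℝ) : ℂ) ^ (z + conj z - 2) / (z + conj z - 2)) * ((a : ℝ) : ℂ)
          + (((T : ℝ) : ℂ) ^ (z - conj z) / (z - conj z)) * conj (w z)
          - (((T : ℝ) : ℂ) ^ (-(z - conj z)) / (z - conj z)) * w z
          - (((T : ℝ) : ℂ) ^ (-(z + conj z - 2)) / (z + conj z - 2)) * β z))‖ ≤ C := by
  -- the outer coefficients near `z₀`
  obtain ⟨B, hB⟩ := exists_norm_outer_le hT (show 1 < ((z₀ : ℂ)).re by simpa using hz₀)
  obtain ⟨Bβ, hBβ⟩ := hβ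
  -- `k₂ := conj(z−z₀)·T^{−(z−z̄)}·d` is `C¹` at `z₀` and real on the punctured real trace
  have hk₂ : ContDiffAt ℝ 1 (fun z : ℂ => conj (z - z₀) * (((T : ℝ) : ℂ) ^ (-(z - conj z)) * d z)) ((z₀ : ℝ) : ℂ) := by
    have hconj : ContDiff ℝ 1 (fun z : ℂ => conj z) := by
      have : (fun z : ℂ => conj z) = ⇑conjCLE := funext fun z => (conjCLE_apply z).symm
      rw [this]; exact conjCLE.contDiff
    exact (hconj.comp (contDiff_id.sub contDiff_const)).contDiffAt.mul (((contDiff_cpow_neg_sub_conj hT).contDiffAt).mul (hd.contDiffAt.restrict_scalars ℝ))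
  have hdw' : ∀ᶠ x : ℝ in 𝓝[≠] z₀, d (x : ℂ) = ((x : ℂ) - z₀) * w (x : ℂ) := by
    have ht : Tendsto (fun x : ℝ => (x : ℂ)) (𝓝[≠] z₀) (𝓝[≠] (z₀ : ℂ)) := by
      refine tendsto_nhdsWithin_of_tendsto_nhds_of_eventually_within _ ((continuous_ofReal.tendsto z₀).mono_left nhdsWithin_le_nhds) ?_
      filter_upwards [self_mem_nhdsWithin] with x hx
      simpa only [mem_compl_iff, mem_singleton_iff, ne_eq, ofReal_inj] using hx
    exact ht.eventually hdw
  have hk₂real : ∀ᶠ x : ℝ in 𝓝[≠] z₀, ((fun z : ℂ => conj (z - z₀) * (((T : ℝ) : ℂ) ^ (-(z - conj z)) * d z)) (x : ℂ)).im = 0 := by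
    filter_upwards [hreal, hdw'] with x hx hxd
    simp only [hxd, conj_ofReal, sub_self, neg_zero, cpow_zero, one_mul, ← ofReal_sub, mul_im, ofReal_re, ofReal_im, hx]
    ring
  obtain ⟨C₁, hC₁⟩ := exists_abs_im_le_mul_abs_im hk₂ hk₂real
  set K₀ : ℝ := ‖((Cμ : ℝ) : ℂ) * ((CK : ℝ) : ℂ)‖ with hK₀
  refine ⟨K₀ * (B * |a| + C₁ + B * Bβ), ?_⟩
  have hball : ∀ᶠ z : ℂ in 𝓝[≠] (z₀ : ℂ), ‖z - z₀‖ ≤ 1 := by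
    filter_upwards [mem_nhdsWithin_of_mem_nhds (Metric.closedBall_mem_nhds (z₀ : ℂ) one_pos)] with z hz
    rwa [Metric.mem_closedBall, dist_eq_norm] at hz
  filter_upwards [mem_nhdsWithin_of_mem_nhds hB, mem_nhdsWithin_of_mem_nhds hC₁, hBβ, hdw, hball] with z hzB hzC hzβ hzd hz1 hzim
  have hB0 : 0 ≤ B := (norm_nonneg _).trans hzB.1
  have hsq : ‖z - z₀‖ ^ 2 ≤ 1 := by nlinarith [norm_nonneg (z - (z₀ : ℂ))]
  -- `|z−z₀|²·|Im k| = |Im k₂|`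
  have hk₂eq : (((‖z - z₀‖ ^ 2 : ℝ)) : ℂ) * (((T : ℝ) : ℂ) ^ (-(z - conj z)) * w z) = conj (z - z₀) * (((T : ℝ) : ℂ) ^ (-(z - conj z)) * d z) := by
    rw [hzd, ofReal_pow, ← conj_mul' (z - z₀)]; ring
  have hmid : ‖z - z₀‖ ^ 2 * (|(((T : ℝ) : ℂ) ^ (-(z - conj z)) * w z).im| / |z.im|) ≤ C₁ := by
    rw [← mul_div_assoc, div_le_iff₀ (abs_pos.2 hzim), ← abs_of_nonneg (sq_nonneg ‖z - (z₀ : ℂ)‖), ← abs_mul, ← im_ofReal_mul, hk₂eq]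
    exact hzC
  calc ‖z - z₀‖ ^ 2 * _ ≤ ‖z - z₀‖ ^ 2 * (K₀ * (‖((T : ℝ) : ℂ) ^ (z + conj z - 2) / (z + conj z - 2)‖ * |a| + |(((T : ℝ) : ℂ) ^ (-(z - conj z)) * w z).im| / |z.im|
          + ‖((T : ℝ) : ℂ) ^ (-(z + conj z - 2)) / (z + conj z - 2)‖ * ‖β z‖)) :=
        mul_le_mul_of_nonneg_left (norm_chiFourTerm_le Cμ CK a hT (w z) (β z) z) (sq_nonneg _)
    _ = K₀ * ((‖z - z₀‖ ^ 2 * ‖((T : ℝ) : ℂ) ^ (z + conj z - 2) / (z + conj z - 2)‖) * |a| + ‖z - z₀‖ ^ 2 * (|(((T : ℝ) : ℂ) ^ (-(z - conj z)) * w z).im| / |z.im|)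
          + ‖((T : ℝ) : ℂ) ^ (-(z + conj z - 2)) / (z + conj z - 2)‖ * (‖z - z₀‖ ^ 2 * ‖β z‖)) := by ring
    _ ≤ K₀ * (B * |a| + C₁ + B * Bβ) := by
        refine mul_le_mul_of_nonneg_left (add_le_add (add_le_add ?_ hmid) ?_) (norm_nonneg _)
        · exact mul_le_mul_of_nonneg_right ((mul_le_mul hsq hzB.1 (norm_nonneg _) zero_le_one).trans_eq (one_mul B)) (abs_nonneg a)
        · exact mul_le_mul hzB.2 hzβ (mul_nonneg (sq_nonneg _) (norm_nonneg _)) hB0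

/-! ## §3 HEAD: the `L²`-bound of the weighted truncated family near the pole, from the relation letter -/

/-- **`‖(z − z₀)•F_T(z)‖ ≤ C` NEAR A REAL POLE `z₀ > 1`, FROM THE MAASS–SELBERG RELATION LETTER** (the `hMS` letter of ★ `exists_L2Residue_of_section`): for a family `F : ℂ → X` continuous on
an open `V` with `z ∈ V` near `z₀` (punctured), the RELATION LETTER `hMSrel : ‖F z‖² ≤ ‖R_χ(z)‖` off the real axis near `z₀` (the diagonal Maass–Selberg relation of the truncated χ-family in
three-scalar currency — an equality there; `≤` suffices), and §2's pole letters: §2 bounds `‖z−z₀‖²·‖F z‖² = ‖(z−z₀)•F z‖²` off the real axis, and ★ `eventually_norm_le_of_im_ne_zero` closes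
across it by continuity. [cite: MoeglinWaldspurger1995, IV.2.3, IV.3.12 (a)] [cite: Arthur1980TraceFormulaII, §4] [cite: Langlands1976, §7] -/
theorem msBound_of_chiRelation {X : Type*} [NormedAddCommGroup X] [NormedSpace ℂ X] (F : ℂ → X) {V : Set ℂ} (hV : IsOpen V) {z₀ : ℝ} (hz₀ : 1 < z₀)
    (hVmem : ∀ᶠ z : ℂ in 𝓝[≠] (z₀ : ℂ), z ∈ V) (hFc : ContinuousOn F V)
    (Cμ CK a : ℝ) {T : ℝ} (hT : 0 < T) {w d β : ℂ → ℂ}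
    (hd : AnalyticAt ℂ d (z₀ : ℂ)) (hdw : ∀ᶠ z : ℂ in 𝓝[≠] (z₀ : ℂ), d z = (z - z₀) * w z) (hreal : ∀ᶠ x : ℝ in 𝓝[≠] z₀, (w (x : ℂ)).im = 0)
    (hβ : ∃ B : ℝ, ∀ᶠ z : ℂ in 𝓝[≠] (z₀ : ℂ), ‖z - z₀‖ ^ 2 * ‖β z‖ ≤ B)
    (hMSrel : ∀ᶠ z : ℂ in 𝓝[≠] (z₀ : ℂ), z.im ≠ 0 →
      ‖F z‖ ^ 2 ≤ ‖((Cμ : ℝ) : ℂ) * (((CK : ℝ) : ℂ) *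
        ((((T : ℝ) : ℂ) ^ (z + conj z - 2) / (z + conj z - 2)) * ((a : ℝ) : ℂ)
          + (((T : ℝ) : ℂ) ^ (z - conj z) / (z - conj z)) * conj (w z)
          - (((T : ℝ) : ℂ) ^ (-(z - conj z)) / (z - conj z)) * w z
          - (((T : ℝ) : ℂ) ^ (-(z + conj z - 2)) / (z + conj z - 2)) * β z))‖) :
    ∃ C : ℝ, ∀ᶠ z : ℂ in 𝓝[≠] (z₀ : ℂ), ‖(z - z₀) • F z‖ ≤ C := by
  obtain ⟨C, hC⟩ := exists_normSq_mul_norm_chiFourTerm_le Cμ CK a hT hz₀ hd hdw hreal hβ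
  have hC0 : ∀ᶠ z : ℂ in 𝓝[≠] (z₀ : ℂ), z.im ≠ 0 → ‖(z - z₀) • F z‖ ≤ Real.sqrt C := by
    filter_upwards [hC, hMSrel] with z hz hrel hzim
    have h1 : ‖(z - z₀) • F z‖ ^ 2 ≤ C := by
      rw [norm_smul, mul_pow]
      exact (mul_le_mul_of_nonneg_left (hrel hzim) (sq_nonneg _)).trans (hz hzim)
    exact Real.le_sqrt_of_sq_le h1
  have hG : ContinuousOn (fun z : ℂ => (z - z₀) • F z) V := (continuous_id.sub continuous_const).continuousOn.smul hFc
  exact ⟨Real.sqrt C, eventually_norm_le_of_im_ne_zero hV hG hVmem hC0⟩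

/-! ## §4 The middle pole `z₀ = 3∕2` -/

/-- **THE MIDDLE-POLE SPELLING** (`z₀ = 3∕2`, exponent `2 − z₀ = ½`): `∃ C, ∀ᶠ z in 𝓝[≠] (3∕2), ‖(z − 3∕2)•F_T z‖ ≤ C` — the `hMS` letter of ★
`K2E1ChiContinuedEisensteinMiddleResidueCMThree.exists_L2Residue_of_section` at `z₀ := 3∕2` VERBATIM, modulo `hMSrel`, `hd`, `hdw`, `hreal`, `hβ`.
[cite: MoeglinWaldspurger1995, IV.2.3, IV.3.12 (a)] [cite: Langlands1976, §7] -/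
theorem msBound_middlePole_of_chiRelation {X : Type*} [NormedAddCommGroup X] [NormedSpace ℂ X] (F : ℂ → X) {V : Set ℂ} (hV : IsOpen V)
    (hVmem : ∀ᶠ z in 𝓝[≠] ((3 / 2 : ℂ)), z ∈ V) (hFc : ContinuousOn F V)
    (Cμ CK a : ℝ) {T : ℝ} (hT : 0 < T) {w d β : ℂ → ℂ}
    (hd : AnalyticAt ℂ d (3 / 2 : ℂ)) (hdw : ∀ᶠ z in 𝓝[≠] ((3 / 2 : ℂ)), d z = (z - 3 / 2) * w z) (hreal : ∀ᶠ x : ℝ in 𝓝[≠] (3 / 2 : ℝ), (w (x : ℂ)).im = 0)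
    (hβ : ∃ B : ℝ, ∀ᶠ z in 𝓝[≠] ((3 / 2 : ℂ)), ‖z - 3 / 2‖ ^ 2 * ‖β z‖ ≤ B)
    (hMSrel : ∀ᶠ z in 𝓝[≠] ((3 / 2 : ℂ)), z.im ≠ 0 →
      ‖F z‖ ^ 2 ≤ ‖((Cμ : ℝ) : ℂ) * (((CK : ℝ) : ℂ) *
        ((((T : ℝ) : ℂ) ^ (z + conj z - 2) / (z + conj z - 2)) * ((a : ℝ) : ℂ)
          + (((T : ℝ) : ℂ) ^ (z - conj z) / (z - conj z)) * conj (w z)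
          - (((T : ℝ) : ℂ) ^ (-(z - conj z)) / (z - conj z)) * w z
          - (((T : ℝ) : ℂ) ^ (-(z + conj z - 2)) / (z + conj z - 2)) * β z))‖) :
    ∃ C : ℝ, ∀ᶠ z in 𝓝[≠] ((3 / 2 : ℂ)), ‖(z - 3 / 2) • F z‖ ≤ C := by
  have h32 : (((3 / 2 : ℝ)) : ℂ) = 3 / 2 := by push_cast; ring
  have h := msBound_of_chiRelation F hV (z₀ := 3 / 2) (by norm_num) (by rw [h32]; exact hVmem) hFc Cμ CK a hT (w := w) (d := d) (β := β)
    (by rw [h32]; exact hd) (by rw [h32]; exact hdw) hreal (by rw [h32]; exact hβ) (by rw [h32]; exact hMSrel)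
  rwa [h32] at h

end Summit.HodgeConjecture.HodgeConjecture.Cruxes.H413.K2E1ChiEisensteinL2BoundMiddlePoleCMThree

end
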